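import Summits.BirchSwinnertonDyer.BirchSwinnertonDyer.Theorems.EisensteinPrimesMazurMCOnX1RankZeroLocate
import Summits.BirchSwinnertonDyer.Rank1Residual.X2.Cells
import HarnessLib

/-!
# Crux `MazurMCOnCellB` (stmt-BirchSwinnertonDyer-19033), line `mudescent`, stub `stub_locate`:
# every X2b pair is `ℚ`-isogenous to one OFF the `μ`-barrier locus (all rational `p`-lines unramified)

Cell `bsd-eis` (FULL-BSD rank-≤1 programme D-0033, HOME `run/shared/lean/pub/bsd-eis/`), seat
`bsd-eis-ky` gen 7 (prover), line `mudescent` = the Λ-adic isogeny μ-descent registered on cruxes 3 and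
5 of route `EisensteinPrimes` (rung K5; judge J ask (γ)). This file LANDS the DESCEND stub of the line
on crux 3 (row A10 = X2b: `r_an = 0`, odd MULTIPLICATIVE `p`, `E[p]` reducible, `¬ GVPar`): at a
multiplicative prime the local input (hL₀) of the étale-end theorem
`EisensteinPrimesMazurMCOnX1RankZeroLocate.exists_isIsogenous_forall_lineUnramifiedAt_of_localLine`
(the crux-5 companion file, same seat) is the TATE LINE `C[p] ≅ μ_p`
(`X2.IsogenyLineType.exists_tateLine_adicCompletionPrime`; Tate uniformisation *ATAEC* V.5.3 / V.5.4
DISCHARGED in the tree), packaged there as `exists_isIsogenous_forall_lineUnramifiedAt_of_mult`; the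
X2b pair supplies `p ≠ 2` and `mult(p)` (`X2.CellB = r_an = 0 ∧ ClassX2 ∧ ¬GVPar`,
`ClassX2 = p ≠ 2 ∧ red ∧ mult`). HONEST FRAMING: an unconditional kernel theorem; it proves NOTHING
about `μ` or the main conjecture; the constructions `stub_analyticMuZero_offLocus` /
`stub_lambdaCount_offLocus` of the line remain OPEN. Example (ky MEMO-4-K5 §1): `219b1 → 219b2` at
`p = 3` split — `219b1` (rational `3`-torsion, line unramified-even, `μ_an = 0`) is the étale end,
`219b2` (image line ramified-odd, `μ_an = 1`) is on the barrier locus. No definition, no named fact.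

References: [GreenbergLNM1716] Conj. 1.11 (p. 58), Prop. 5.7 (p. 113: «good, ordinary or
multiplicative reduction at p»); [SilvermanATAEC1994] V.5.3–5.4; [GreenbergVatsal2000] §2 pp. 14–15,
p. 28; HOME/ky-g7/Lines-mudescent-MazurMCOnCellB.lean.
-/

set_option autoImplicit false

noncomputable section

open scoped Classical

open WeierstrassCurve Literature.NumberTheory.EllipticCurves
  Literature.NumberTheory.EllipticCurves.Rank1Residual
  Literature.Barriers.BirchSwinnertonDyer
  Summit.BirchSwinnertonDyer.Rank1Residual
  Summit.BirchSwinnertonDyer.BirchSwinnertonDyer.Theorems.EisensteinPrimesMazurMCOnX1RankZeroLocate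

-- `Summit.BirchSwinnertonDyer.BirchSwinnertonDyer.…`: the summit and its single sub-problem share a name (D-0017 layout).
set_option linter.dupNamespace false

namespace Summit.BirchSwinnertonDyer.BirchSwinnertonDyer.Theorems.EisensteinPrimesMazurMCOnCellBLocate

/-- **`stub_locate` (line `mudescent`, crux `MazurMCOnCellB`, stmt-BirchSwinnertonDyer-19033) — DESCEND:
every X2b pair is `ℚ`-isogenous to one OFF the `μ`-barrier locus.** For `W` globally minimal elliptic
and `p` with `X2.CellB W p` (`r_an = 0`, `p ≠ 2` multiplicative, `E[p]` reducible, `¬ GVPar`): there is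
a globally minimal elliptic `W₀` with `IsIsogenous W W₀` and `¬ HasRamifiedOddLineAt W₀ p` — indeed one
ALL of whose rational `p`-lines are unramified at `p` (`exists_isIsogenous_forall_lineUnramifiedAt_of_mult`,
the Tate line as (hL₀); only `p ≠ 2` and `mult(p)` of the cell clause are used). Exactly the registered
signature. [cite: GreenbergLNM1716, Conj. 1.11 (p. 58) and Prop. 5.7 (p. 113)]
[cite: SilvermanATAEC1994, Thm. V.5.3 and Cor. V.5.4] -/
theorem stub_locate :
    ∀ (W : WeierstrassCurve ℚ) [W.IsElliptic] [W.IsGloballyMinimal] (p : ℕ) [Fact p.Prime],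
      X2.CellB W p →
        ∃ (W₀ : WeierstrassCurve ℚ) (_ : W₀.IsElliptic) (_ : W₀.IsGloballyMinimal),
          IsIsogenous W W₀ ∧ ¬ HasRamifiedOddLineAt W₀ p := by
  intro W _ _ p _ hc
  obtain ⟨W₀, hW₀, hmin, hiso, hunr⟩ :=
    exists_isIsogenous_forall_lineUnramifiedAt_of_mult (V := W) hc.2.1.1 hc.2.1.2.2
  exact ⟨W₀, hW₀, hmin, hiso, not_hasRamifiedOddLineAt_of_forall_lineUnramifiedAt hunr⟩

end Summit.BirchSwinnertonDyer.BirchSwinnertonDyer.Theorems.EisensteinPrimesMazurMCOnCellBLocate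

end
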